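import Mathlib
import HarnessLib
import Summits.NavierStokesRegularity.NavierStokesRegularity.Theorems.LocalSineTubeDoorGenericDoor
import Summits.NavierStokesRegularity.NavierStokesRegularity.Theorems.LocalSineTubeDoorProfileAlignedWindowRigidityAncient
import Summits.NavierStokesRegularity.NavierStokesRegularity.Theorems.PoloidalWindowDoorPoloidalWindowRigidityDegenerate
import Summits.NavierStokesRegularity.NavierStokesRegularity.Theorems.PoloidalWindowDoorPoloidalWindowRigidityErtelCollapseDirection

/-!
# The one-window door family — THE VORTEX-STRETCHING DOOR (unconditional): no Type-I singularity where the stretching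
# vector `(ω·∇)u` fades on one similarity window

Cell ns-regularity-ideate, seat p6 (route-directed support for nsreg-p1's door family; anchor
`--supports stmt-NavierStokesRegularity-20017`; rung N0-LocalTubeDoorSine neighbourhood).  The generic first-order
template `…LocalSineTubeDoorGenericDoor.genericDoor_of_profileRigidity` with the scalar `F(x, A) = ‖A (curlCLM A)‖` — the
magnitude of the VORTEX-STRETCHING VECTOR `(ω·∇)u = Du ω`, `ω = curl u` — whose profile crux is a THEOREM by the cell's
ERTEL COLLAPSE (nsreg-p6 g3, `…ErtelCollapseDirection.inner_curl_eq_zero_of_inner_stretching_eq_zero`: on the Type-I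
profile class, if the `e`-component of the stretching vanishes identically then so does the `e`-component of the
vorticity — KNSS Lemma 2.1 + planar flux): a profile with `Dv(s)(curl v(s)) ≡ 0` on every slice has `curl v ≡ 0` (three
directions), hence vanishes (`…Degenerate.nonflatLiouville_of_irrotational`).  Window → slab by slice analyticity.
Result (`localTubeDoorStretching`):

  for a classical Leray–Hopf solution on `[0,T)` from rapidly decaying data that is LOCALLY Type I at `(x₀,T)`, if the
  scale-normalised stretching vector fades in `L¹` over ONE nonempty open similarity window,
  `∫_U (T−t)² ‖((ω·∇)u)(t, x₀ + √(T−t)y)‖ dy → 0` as `t → T⁻`, then `u` stays bounded near `x₀` up to `T`.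

So at a locally Type-I singularity VORTEX STRETCHING MUST PERSIST, in scale-invariant `L¹`, on EVERY similarity window
(along some sequence of times).  `(T−t)²` is the scale-invariant normalisation (`ω ∼ (T−t)^{-1}`, `∇u ∼ (T−t)^{-1}`).

* `analyticOnNhd_stretching_slice`, `stretchingWindowToSlab` — slice analyticity of `y ↦ Dv(s)(y)[curl v(s)(y)]`;
* `not_backwardSingular_of_stretching_eq_zero`, `stretchingProfileRigidity` — the profile slab crux (Ertel collapse ×3);
* `continuous_stretchNorm`, `stretchNorm_zeroSet_invariant` — template side conditions;
* `localTubeDoorStretching` — the door.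

WHAT THIS IS NOT: not a claim about Navier–Stokes regularity (Clay A) — a LOCAL regularity CRITERION conditional on
local Type I (bears_on LADDER-NS N0); establishment in the cell's sense needs the cross-family referee PASS +
independent reproduction.
-/

noncomputable section

-- the summit and its single sub-problem share the name (CONVENTIONS §1), as in every Theorems file
set_option linter.dupNamespace false

namespace Summit.NavierStokesRegularity.NavierStokesRegularity.Theorems.LocalSineTubeDoorStretchingDoor

open MeasureTheory Set Function Filter Topology TopologicalSpace Metric
open scoped RealInnerProductSpace InnerProductSpace NNReal ENNReal
open Literature.Analysis Literature.Analysis.FluidPDE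
open Summit.NavierStokesRegularity.NavierStokesRegularity.Theorems.LocalSineTubeDoorGenericDoor
open Summit.NavierStokesRegularity.NavierStokesRegularity.Theorems.LocalSineTubeDoorProfileAlignedWindowRigidityAncient
open Summit.NavierStokesRegularity.NavierStokesRegularity.Theorems.PoloidalWindowDoorPoloidalWindowRigidityDegenerate
open Summit.NavierStokesRegularity.NavierStokesRegularity.Theorems.PoloidalWindowDoorPoloidalWindowRigidityErtelCollapseDirection

variable {C : ℝ} {v : ℝ → EuclideanSpace ℝ (Fin 3) → EuclideanSpace ℝ (Fin 3)}

/-! ### profile side: the stretching vector of a slice is real-analytic; Ertel collapse in three directions -/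

/-- **The stretching vector `y ↦ Dv(s)(y)[curl v(s)(y)]` of a slice of a profile of the class is real-analytic.** -/
theorem analyticOnNhd_stretching_slice (hrate : HasTypeITimeDecay C v)
    (hcont : ContinuousOn (uncurry v) (Iio (0 : ℝ) ×ˢ univ))
    (hmild : ∀ s t : ℝ, s < t → t < 0 → ∀ x,
      v t x = UnboundedOperators.heatExtension (v s) (t - s) x - oseenDuhamel 1 s v v t x)
    {s : ℝ} (hs : s < 0) :
    AnalyticOnNhd ℝ (fun y => fderiv ℝ (v s) y (curl (v s) y)) univ := by
  have hslice := analyticOnNhd_slice hcont (bdd_of_hasTypeITimeDecay hrate) hmild hs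
  have hcurl := analyticOnNhd_curl hslice
  intro y hy
  exact ((ContinuousLinearMap.id ℝ (EuclideanSpace ℝ (Fin 3) →L[ℝ] EuclideanSpace ℝ (Fin 3))).analyticAt_bilinear
    (fderiv ℝ (v s) y, curl (v s) y)).comp₂ (hslice.fderiv y hy) (hcurl y hy)

/-- **Window → slab for the stretching vector**: for a profile of the class, if at every `s < 0` the stretching vector
vanishes on some nonempty open window, it vanishes on every slice (identity theorem). -/
theorem stretchingWindowToSlab (hrate : HasTypeITimeDecay C v)
    (hcont : ContinuousOn (uncurry v) (Iio (0 : ℝ) ×ˢ univ))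
    (hmild : ∀ s t : ℝ, s < t → t < 0 → ∀ x,
      v t x = UnboundedOperators.heatExtension (v s) (t - s) x - oseenDuhamel 1 s v v t x)
    (hwin : ∀ s < 0, ∃ U : Set (EuclideanSpace ℝ (Fin 3)), IsOpen U ∧ U.Nonempty ∧
      ∀ y ∈ U, fderiv ℝ (v s) y (curl (v s) y) = 0) :
    ∀ s < 0, ∀ y, fderiv ℝ (v s) y (curl (v s) y) = 0 := by
  intro s hs y
  obtain ⟨U, hU, ⟨y₀, hy₀⟩, hal⟩ := hwin s hs
  have hev : (fun y => fderiv ℝ (v s) y (curl (v s) y)) =ᶠ[𝓝 y₀] 0 :=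
    Filter.eventually_of_mem (hU.mem_nhds hy₀) fun y hy => hal y hy
  exact (analyticOnNhd_stretching_slice hrate hcont hmild hs).eqOn_zero_of_preconnected_of_eventuallyEq_zero
    isPreconnected_univ (mem_univ y₀) hev (mem_univ y)

/-- **STRETCHING-FREE TYPE-I PROFILES ARE TRIVIAL** (not backward-singular): if the stretching vector `Dv(s)(curl v(s))`
vanishes on every slice, the Ertel collapse along `e₀, e₁, e₂` (`…ErtelCollapseDirection`) kills every component of the
vorticity, and irrotational profiles of the class vanish (`…Degenerate`). -/
theorem not_backwardSingular_of_stretching_eq_zero (hrate : HasTypeITimeDecay C v)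
    (hcont : ContinuousOn (uncurry v) (Iio (0 : ℝ) ×ˢ univ))
    (hmild : ∀ s t : ℝ, s < t → t < 0 → ∀ x,
      v t x = UnboundedOperators.heatExtension (v s) (t - s) x - oseenDuhamel 1 s v v t x)
    (hdiv : ∀ t < 0, VectorCalculus.IsDivFree (v t))
    (hstr : ∀ s < 0, ∀ y, fderiv ℝ (v s) y (curl (v s) y) = 0) : ¬ IsBackwardSingularPoint v 0 := by
  refine nonflatLiouville_of_irrotational hrate hcont hmild hdiv fun s hs y => ?_
  have hcomp : ∀ i : Fin 3, ⟪curl (v s) y, EuclideanSpace.single i (1 : ℝ)⟫_ℝ = 0 := fun i => by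
    have he : (EuclideanSpace.single i (1 : ℝ) : EuclideanSpace ℝ (Fin 3)) ≠ 0 := by
      intro h0
      have := congrArg (fun w : EuclideanSpace ℝ (Fin 3) => w i) h0
      simp at this
    exact inner_curl_eq_zero_of_inner_stretching_eq_zero hrate hcont hmild hdiv he
      (fun s' hs' y' => by rw [hstr s' hs' y', inner_zero_left]) s hs y
  ext i
  have h := hcomp i
  rw [EuclideanSpace.inner_single_right] at h
  simpa using h

/-- **The profile SLAB crux of the stretching door, in the template's `F`-form** (`F(x, A) = ‖A (curlCLM A)‖`). -/
theorem stretchingProfileRigidity :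
    ∀ (C : ℝ) (v : ℝ → EuclideanSpace ℝ (Fin 3) → EuclideanSpace ℝ (Fin 3)),
      Literature.Analysis.FluidPDE.HasTypeITimeDecay C v →
      ContinuousOn (Function.uncurry v) (Set.Iio (0 : ℝ) ×ˢ Set.univ) →
      (∀ s t : ℝ, s < t → t < 0 → ∀ x, v t x =
        Literature.Analysis.UnboundedOperators.heatExtension (v s) (t - s) x -
          Literature.Analysis.FluidPDE.oseenDuhamel 1 s v v t x) →
      (∀ t < 0, Literature.Analysis.FluidPDE.VectorCalculus.IsDivFree (v t)) →
      (∀ s < 0, ∀ z, (fun (_ : EuclideanSpace ℝ (Fin 3)) (A : EuclideanSpace ℝ (Fin 3) →L[ℝ] EuclideanSpace ℝ (Fin 3)) =>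
          ‖A (Literature.Analysis.FluidPDE.curlCLM A)‖) (v s z) (fderiv ℝ (v s) z) = 0) →
      ¬ Literature.Analysis.FluidPDE.IsBackwardSingularPoint v 0 := by
  intro C v hrate hcont hmild hdiv hslab
  refine not_backwardSingular_of_stretching_eq_zero hrate hcont hmild hdiv fun s hs y => ?_
  have h := hslab s hs y
  simp only [norm_eq_zero] at h
  rwa [← curl_eq_curlCLM] at h

/-- **Window → slab in the template's `F`-form.** -/
theorem stretchingWindowToSlabF :
    ∀ (C : ℝ) (v : ℝ → EuclideanSpace ℝ (Fin 3) → EuclideanSpace ℝ (Fin 3)),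
      Literature.Analysis.FluidPDE.HasTypeITimeDecay C v →
      ContinuousOn (Function.uncurry v) (Set.Iio (0 : ℝ) ×ˢ Set.univ) →
      (∀ s t : ℝ, s < t → t < 0 → ∀ x, v t x =
        Literature.Analysis.UnboundedOperators.heatExtension (v s) (t - s) x -
          Literature.Analysis.FluidPDE.oseenDuhamel 1 s v v t x) →
      (∀ t < 0, Literature.Analysis.FluidPDE.VectorCalculus.IsDivFree (v t)) →
      (∀ s < 0, ∃ U : Set (EuclideanSpace ℝ (Fin 3)), IsOpen U ∧ U.Nonempty ∧
        ∀ z ∈ U, (fun (_ : EuclideanSpace ℝ (Fin 3)) (A : EuclideanSpace ℝ (Fin 3) →L[ℝ] EuclideanSpace ℝ (Fin 3)) =>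
          ‖A (Literature.Analysis.FluidPDE.curlCLM A)‖) (v s z) (fderiv ℝ (v s) z) = 0) →
      ∀ s < 0, ∀ z, (fun (_ : EuclideanSpace ℝ (Fin 3)) (A : EuclideanSpace ℝ (Fin 3) →L[ℝ] EuclideanSpace ℝ (Fin 3)) =>
          ‖A (Literature.Analysis.FluidPDE.curlCLM A)‖) (v s z) (fderiv ℝ (v s) z) = 0 := by
  intro C v hrate hcont hmild _ hwin s hs z
  have hall := stretchingWindowToSlab hrate hcont hmild (fun s' hs' => by
    obtain ⟨U, hU, hne, hal⟩ := hwin s' hs'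
    refine ⟨U, hU, hne, fun y hy => ?_⟩
    have h := hal y hy
    simp only [norm_eq_zero] at h
    rwa [← curl_eq_curlCLM] at h) s hs z
  simp only [norm_eq_zero]
  rwa [← curl_eq_curlCLM]

/-! ### the door -/

/-- The stretching scalar `F(x, A) = ‖A (curlCLM A)‖` is continuous in `(x, A)`. -/
theorem continuous_stretchNorm :
    Continuous fun q : EuclideanSpace ℝ (Fin 3) × (EuclideanSpace ℝ (Fin 3) →L[ℝ] EuclideanSpace ℝ (Fin 3)) =>
      ‖q.2 (curlCLM q.2)‖ :=
  continuous_norm.comp (isBoundedBilinearMap_apply.continuous.comp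
    (continuous_snd.prodMk (curlCLM.continuous.comp continuous_snd)))

/-- The zero set of `F(x, A) = ‖A (curlCLM A)‖` is invariant under positive rescalings. -/
theorem stretchNorm_zeroSet_invariant :
    ∀ (a b : ℝ), 0 < a → 0 < b → ∀ (x : EuclideanSpace ℝ (Fin 3))
      (A : EuclideanSpace ℝ (Fin 3) →L[ℝ] EuclideanSpace ℝ (Fin 3)), ‖(b • A) (curlCLM (b • A))‖ = 0 ↔ ‖A (curlCLM A)‖ = 0 := by
  intro a b _ hb x A
  rw [map_smul, _root_.smul_apply, map_smul, smul_smul, norm_smul, mul_eq_zero, Real.norm_eq_abs, abs_eq_zero,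
    mul_self_eq_zero, or_iff_right hb.ne']

/-- **THE VORTEX-STRETCHING DOOR — unconditional.**  A classical Leray–Hopf solution on `[0,T)` from rapidly decaying
data, LOCALLY Type I at `(x₀,T)`, whose scale-normalised stretching vector `(T−t)² (ω·∇)u` fades in `L¹` over one
nonempty open similarity window `x₀ + √(T−t) U` as `t → T⁻`, is backward bounded at `x₀`. -/
theorem localTubeDoorStretching :
    ∀ (ν T : ℝ), 0 < ν → 0 < T → ∀ (u : ℝ → EuclideanSpace ℝ (Fin 3) → EuclideanSpace ℝ (Fin 3))
      (p : ℝ → EuclideanSpace ℝ (Fin 3) → ℝ),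
    Literature.Analysis.FluidPDE.IsClassicalNSSolutionOn (Set.Ico 0 T) ν 0 u p →
    Literature.Analysis.FluidPDE.IsLerayHopfOn T ν 0 (u 0) u →
    Literature.Analysis.FluidPDE.HasRapidSpatialDecay (u 0) →
    ∀ (x₀ : EuclideanSpace ℝ (Fin 3)) (ρ M : ℝ), 0 < ρ →
    (∀ t ∈ Set.Ico 0 T, T - ρ ^ 2 < t → ∀ x ∈ Metric.ball x₀ ρ, ‖u t x‖ * Real.sqrt (ν * (T - t)) ≤ M) →
    ∀ (U : Set (EuclideanSpace ℝ (Fin 3))), IsOpen U → U.Nonempty →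
    Filter.Tendsto (fun t => ∫⁻ y in U, ENNReal.ofReal
      ((T - t) ^ 2 * ‖fderiv ℝ (u t) (x₀ + Real.sqrt (T - t) • y)
        (Literature.Analysis.FluidPDE.curl (u t) (x₀ + Real.sqrt (T - t) • y))‖))
      (nhdsWithin T (Set.Iio T)) (nhds 0) →
    Literature.Analysis.FluidPDE.IsBackwardBoundedAt u T x₀ := by
  intro ν T hν hT u p hsol hLH hdec x₀ ρ M hρ hM U hU hUne hfade
  refine genericDoor_of_profileRigidity (fun _ A => ‖A (curlCLM A)‖) continuous_stretchNorm
    stretchNorm_zeroSet_invariant stretchingWindowToSlabF stretchingProfileRigidity ν T hν hT u p hsol hLH hdec x₀ ρ M hρ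
    hM U hU hUne ?_
  have hev : ∀ᶠ t in nhdsWithin T (Set.Iio T), t < T := eventually_nhdsWithin_of_forall fun t ht => ht
  refine hfade.congr' (hev.mono fun t ht => ?_)
  refine lintegral_congr fun y => ?_
  have hs : 0 ≤ T - t := (sub_pos.2 ht).le
  rw [map_smul, _root_.smul_apply, map_smul, smul_smul, ← curl_eq_curlCLM, norm_smul, Real.sq_sqrt hs,
    Real.norm_eq_abs, abs_of_nonneg (mul_nonneg hs hs), ← sq, abs_of_nonneg (mul_nonneg (sq_nonneg _) (norm_nonneg _))]

end Summit.NavierStokesRegularity.NavierStokesRegularity.Theorems.LocalSineTubeDoorStretchingDoor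

end
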